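import Mathlib.AlgebraicGeometry.Limits
import Mathlib.AlgebraicGeometry.Morphisms.ClosedImmersion
import Mathlib.AlgebraicGeometry.Geometrically.Irreducible
import HarnessLib

/-!
# A connected open-and-closed piece of a coproduct of schemes is one of the summands

Topic: `Literature/AlgebraicGeometry/Morphisms`.  PROOF FILE (theorems only; no definition, no named
fact).  Let `(f_i : X_i ⟶ S)_{i ∈ σ}` be a COLIMIT cofan in `Scheme` (so `S ≅ ∐_i X_i`; Mathlib
`AlgebraicGeometry.nonempty_isColimit_cofanMk_of` is the converse direction).  Then

* `isIso_sigmaDesc_of_isColimit_cofan`, `isOpenImmersion_of_isColimit_cofan`,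
  `pairwise_disjoint_range_of_isColimit_cofan`, `iUnion_range_of_isColimit_cofan`,
  `isClopen_range_of_isColimit_cofan` — the legs are open immersions with pairwise disjoint,
  covering, open-and-closed images (transport of Mathlib's `Sigma.ι` API `sigmaι_eq_iff`,
  `sigmaOpenCover` along the comparison isomorphism `Sigma.desc f : ∐ X ≅ S`);
* `exists_eq_range_of_isColimit_cofan` — if the summands are preconnected, every non-empty
  preconnected open-and-closed subset of `S` IS the image of one leg (a preconnected set meeting a
  clopen set lies inside it, Mathlib `IsPreconnected.subset_isClopen`, applied twice);
* `exists_iso_comp_eq_of_isColimit_cofan` — hence a connected scheme `E` mapping to `S` by an open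
  immersion with closed image (e.g. an open AND closed immersion,
  `exists_iso_comp_eq_of_isColimit_cofan'`) is isomorphic OVER `S` to one of the summands
  (Mathlib `IsOpenImmersion.isoOfRangeEq`);
* `exists_overIso_comp_eq_of_isColimit_cofan` (`'`) — the same for a colimit cofan in `Over B`
  (e.g. the tree's `SchemeOver k = Over (Spec k)`): `Over.forget` creates, hence preserves, the
  coproduct (`isColimit_cofan_left`), and the isomorphism of underlying schemes is automatically a
  `B`-isomorphism; `exists_overIso_comp_eq_of_geometricallyIrreducible` — the consumer form over a
  one-point base (`B = Spec k`): summands and piece GEOMETRICALLY IRREDUCIBLE over `B` (the field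
  `geometricallyIrreducible` of the tree's `IsSmoothProjective`), irreducible hence connected by
  Mathlib `GeometricallyIrreducible.irreducibleSpace_of_subsingleton`.

This is the elementary fact "the connected components of `∐ X_i` with connected `X_i` are the
`X_i`" (Görtz–Wedhorn I, §(3.11) and Exercise 3.16; Stacks 080G/04PX for the topology), in the form
consumed when a statement quantified over ALL open-closed connected pieces `E ↪ S` is to be fed
from a SPECIFIC decomposition `S ≅ ∐_c X_c` (cells pub-hodgecm / pub-hodgecm2, TEAM hComp: the
hypothesis `hpiece` of pin-1's `Model.exists_treeCofan_of_pieces` against the cofans of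
`HodgeTheory.exists_components_isSmoothProjective_isColimit` /
`UnitaryCanonicalModel.RecordSystem.pieces`; smooth projective geometrically irreducible pieces are
irreducible, hence connected, spaces).  Mathlib searched (pin): `sigmaι_eq_iff`,
`disjoint_opensRange_sigmaι`, `sigmaOpenCover`, `nonempty_isColimit_cofanMk_of`,
`Cofan.nonempty_isColimit_iff_isIso_sigmaDesc`, `IsOpenImmersion.isoOfRangeEq(_hom_fac)`,
`IsPreconnected.subset_isClopen`, `Cofan.isColimitMapCoconeEquiv`, `Over.createsColimitsOfSize`
(used); no statement identifying a clopen piece of a coproduct with a summand.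

## References
* [GortzWedhorn2020] U. Görtz, T. Wedhorn, *Algebraic Geometry I: Schemes* (2nd ed. 2020), §(3.11)
  (coproducts of schemes are disjoint unions) and Exercise 3.16.
* [StacksProject] The Stacks Project, Tags 080G, 04PX (connected components; clopen subsets).
-/

set_option autoImplicit false

noncomputable section

open CategoryTheory CategoryTheory.Limits AlgebraicGeometry Set Function

namespace Literature.AlgebraicGeometry.Morphisms

open _root_.Topology

universe v u

section Scheme

variable {σ : Type v} [Small.{u} σ] {X : σ → Scheme.{u}} {S : Scheme.{u}} {f : ∀ i, X i ⟶ S}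

/-- The comparison map `Sigma.desc f : ∐ X ⟶ S` of a colimit cofan `(f_i : X_i ⟶ S)` is an
isomorphism (uniqueness of colimits; Mathlib `Cofan.nonempty_isColimit_iff_isIso_sigmaDesc`;
Görtz–Wedhorn I, §(3.11)). [cite: GortzWedhorn2020, §(3.5) Proposition 3.10 and Example 3.11 (disjoint union of schemes, p. 73)] -/
theorem isIso_sigmaDesc_of_isColimit_cofan (hc : IsColimit (Cofan.mk S f)) :
    IsIso (Sigma.desc f) := by
  have h := (Cofan.nonempty_isColimit_iff_isIso_sigmaDesc (Cofan.mk S f)).mp ⟨hc⟩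
  simp only [cofan_mk_inj] at h
  exact h

/-- **The legs of a colimit cofan of schemes are open immersions** (each `X_i ⟶ ∐ X` is an open
immersion, Mathlib's instance for `Sigma.ι`, composed with the comparison isomorphism;
Görtz–Wedhorn I, §(3.11)). [cite: GortzWedhorn2020, §(3.5) Proposition 3.10 and Example 3.11 (disjoint union of schemes, p. 73)] -/
theorem isOpenImmersion_of_isColimit_cofan (hc : IsColimit (Cofan.mk S f)) (i : σ) :
    IsOpenImmersion (f i) := by
  haveI := isIso_sigmaDesc_of_isColimit_cofan hc
  haveI : IsOpenImmersion (Sigma.ι X i) := (sigmaOpenCover X).map_prop i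
  rw [← Sigma.ι_desc f i]
  infer_instance

/-- **The images of the legs of a colimit cofan of schemes are pairwise disjoint** (Mathlib
`sigmaι_eq_iff` for `∐ X`, transported along the comparison isomorphism; Görtz–Wedhorn I, §(3.11)).
[cite: GortzWedhorn2020, §(3.5) Proposition 3.10 and Example 3.11 (disjoint union of schemes, p. 73)] -/
theorem pairwise_disjoint_range_of_isColimit_cofan (hc : IsColimit (Cofan.mk S f)) :
    Pairwise (Disjoint on fun i => Set.range (f i)) := by
  haveI := isIso_sigmaDesc_of_isColimit_cofan hc
  intro i j hij
  refine Set.disjoint_left.mpr ?_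
  rintro s ⟨x, rfl⟩ ⟨y, hy⟩
  have hx : f i x = Sigma.desc f (Sigma.ι X i x) := by
    rw [← Scheme.Hom.comp_apply, Sigma.ι_desc]
  have hy' : f j y = Sigma.desc f (Sigma.ι X j y) := by
    rw [← Scheme.Hom.comp_apply, Sigma.ι_desc]
  have hinj : Function.Injective (Sigma.desc f) := (Sigma.desc f).homeomorph.injective
  have heq : Sigma.ι X j y = Sigma.ι X i x := hinj (by rw [← hx, ← hy', hy])
  obtain ⟨rfl, -⟩ := Sigma.mk.inj_iff.mp ((sigmaι_eq_iff X j i y x).mp heq)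
  exact hij rfl

/-- Every point of the apex of a colimit cofan of schemes lies in the image of some leg (Mathlib
`sigmaOpenCover` for `∐ X`, transported along the comparison isomorphism; Görtz–Wedhorn I,
§(3.11)). [cite: GortzWedhorn2020, §(3.5) Proposition 3.10 and Example 3.11 (disjoint union of schemes, p. 73)] -/
theorem exists_eq_of_isColimit_cofan (hc : IsColimit (Cofan.mk S f)) (s : S) :
    ∃ (i : σ) (y : X i), f i y = s := by
  haveI := isIso_sigmaDesc_of_isColimit_cofan hc
  obtain ⟨i, y, hy⟩ := (sigmaOpenCover X).exists_eq (inv (Sigma.desc f) s)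
  change σ at i
  change ↥(X i) at y
  refine ⟨i, y, ?_⟩
  rw [sigmaOpenCover_f] at hy
  have hy' : Sigma.ι X i y = inv (Sigma.desc f) s := hy
  rw [← Sigma.ι_desc f i, Scheme.Hom.comp_apply, hy', ← Scheme.Hom.comp_apply, IsIso.inv_hom_id]
  rfl

/-- **The images of the legs of a colimit cofan of schemes cover** (union form of
`exists_eq_of_isColimit_cofan`; Görtz–Wedhorn I, §(3.11)). [cite: GortzWedhorn2020, §(3.5) Proposition 3.10 and Example 3.11 (disjoint union of schemes, p. 73)] -/
theorem iUnion_range_of_isColimit_cofan (hc : IsColimit (Cofan.mk S f)) :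
    ⋃ i, Set.range (f i) = Set.univ := by
  refine Set.eq_univ_of_forall fun s => Set.mem_iUnion.mpr ?_
  obtain ⟨i, y, hy⟩ := exists_eq_of_isColimit_cofan hc s
  exact ⟨i, y, hy⟩

/-- **The images of the legs of a colimit cofan of schemes are open and closed**: open as images of
open immersions, closed because the complement is the union of the other (open) images
(Görtz–Wedhorn I, §(3.11); Stacks 04PX). [cite: GortzWedhorn2020, §(3.5) Proposition 3.10 and Example 3.11 (disjoint union of schemes, p. 73)] -/
theorem isClopen_range_of_isColimit_cofan (hc : IsColimit (Cofan.mk S f)) (i : σ) :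
    IsClopen (Set.range (f i)) := by
  haveI : ∀ j, IsOpenImmersion (f j) := isOpenImmersion_of_isColimit_cofan hc
  refine ⟨⟨?_⟩, IsOpenImmersion.isOpen_range (f i)⟩
  have hcompl : (Set.range (f i))ᶜ = ⋃ j ∈ {j : σ | j ≠ i}, Set.range (f j) := by
    ext s
    simp only [Set.mem_compl_iff, Set.mem_iUnion, Set.mem_setOf_eq, exists_prop]
    constructor
    · intro hs
      obtain ⟨j, y, hy⟩ := exists_eq_of_isColimit_cofan hc s
      refine ⟨j, ?_, y, hy⟩
      rintro rfl
      exact hs ⟨y, hy⟩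
    · rintro ⟨j, hji, hs⟩ hs'
      exact Set.disjoint_left.mp (pairwise_disjoint_range_of_isColimit_cofan hc hji) hs hs'
  rw [hcompl]
  exact isOpen_biUnion fun j _ => IsOpenImmersion.isOpen_range (f j)

/-- **A non-empty preconnected open-and-closed subset of a coproduct of preconnected schemes is one
of the summands.**  If `(f_i : X_i ⟶ S)` is a colimit cofan with every `X_i` preconnected, then a
preconnected clopen `U ⊆ S` meeting the image of `f_i` both contains it (the image is preconnected,
`U` is clopen) and is contained in it (the image is clopen, `U` is preconnected); Mathlib
`IsPreconnected.subset_isClopen` twice (Stacks 080G; Görtz–Wedhorn I, Exercise 3.16). [cite: GortzWedhorn2020, Lemma 1.19 (1) (§(1.5)) with §(3.5) Example 3.11 (p. 73)] -/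
theorem exists_eq_range_of_isColimit_cofan (hc : IsColimit (Cofan.mk S f))
    [∀ i, PreconnectedSpace (X i)] {U : Set S} (hU : IsClopen U) (hU' : _root_.IsPreconnected U)
    (hne : U.Nonempty) : ∃ i, U = Set.range (f i) := by
  obtain ⟨s, hs⟩ := hne
  obtain ⟨i, y, hy⟩ := exists_eq_of_isColimit_cofan hc s
  refine ⟨i, Set.Subset.antisymm ?_ ?_⟩
  · exact hU'.subset_isClopen (isClopen_range_of_isColimit_cofan hc i) ⟨s, hs, y, hy⟩
  · exact (isPreconnected_range (f i).continuous).subset_isClopen hU ⟨s, ⟨y, hy⟩, hs⟩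

/-- **A connected scheme mapping to a coproduct of preconnected schemes by an open immersion with
closed image is isomorphic, over the apex, to one of the summands**: its image is a non-empty
connected clopen subset, hence the image of some leg (`exists_eq_range_of_isColimit_cofan`), and
two open immersions with the same image are isomorphic over the target (Mathlib
`IsOpenImmersion.isoOfRangeEq`) (Görtz–Wedhorn I, §(3.11), Exercise 3.16). [cite: GortzWedhorn2020, Lemma 1.19 (1) (§(1.5)) with §(3.5) Example 3.11 (p. 73)] -/
theorem exists_iso_comp_eq_of_isColimit_cofan (hc : IsColimit (Cofan.mk S f))
    [∀ i, PreconnectedSpace (X i)] {E : Scheme.{u}} (j : E ⟶ S) [IsOpenImmersion j]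
    (hj : IsClosed (Set.range j)) [ConnectedSpace E] :
    ∃ (i : σ) (φ : E ≅ X i), φ.hom ≫ f i = j := by
  obtain ⟨i, hi⟩ := exists_eq_range_of_isColimit_cofan hc
    ⟨hj, IsOpenImmersion.isOpen_range j⟩ (isPreconnected_range j.continuous) (Set.range_nonempty _)
  haveI := isOpenImmersion_of_isColimit_cofan hc i
  exact ⟨i, IsOpenImmersion.isoOfRangeEq j (f i) hi, IsOpenImmersion.isoOfRangeEq_hom_fac _ _ _⟩

/-- **An open-and-closed immersion of a connected scheme into a coproduct of preconnected schemes is,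
over the apex, the inclusion of one of the summands** (`exists_iso_comp_eq_of_isColimit_cofan` with
the closed image supplied by the closed immersion; Görtz–Wedhorn I, §(3.11), Exercise 3.16).
[cite: GortzWedhorn2020, Lemma 1.19 (1) (§(1.5)) with §(3.5) Example 3.11 (p. 73)] -/
theorem exists_iso_comp_eq_of_isColimit_cofan' (hc : IsColimit (Cofan.mk S f))
    [∀ i, PreconnectedSpace (X i)] {E : Scheme.{u}} (j : E ⟶ S) [IsOpenImmersion j]
    [IsClosedImmersion j] [ConnectedSpace E] :
    ∃ (i : σ) (φ : E ≅ X i), φ.hom ≫ f i = j :=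
  exists_iso_comp_eq_of_isColimit_cofan hc j j.isClosedEmbedding.isClosed_range

end Scheme

section Over

variable {σ : Type v} [Small.{u} σ] {B : Scheme.{u}} {X : σ → Over B} {S : Over B}
  {f : ∀ i, X i ⟶ S}

/-- A colimit cofan in `Over B` is a colimit cofan of the underlying schemes (`Over.forget B`
creates colimits, Mathlib `Over.createsColimitsOfSize`, and `Scheme` has coproducts, so it
preserves them; Görtz–Wedhorn I, §(3.11) and §(4.9)). [cite: GortzWedhorn2020, §(3.5) Proposition 3.10 and Example 3.11 (disjoint union of schemes, p. 73)] -/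
theorem isColimit_cofan_left (hc : IsColimit (Cofan.mk S f)) :
    Nonempty (IsColimit (Cofan.mk S.left fun i => (f i).left)) :=
  ⟨Cofan.isColimitMapCoconeEquiv (Over.forget B) X (Cofan.mk S f)
    (isColimitOfPreserves (Over.forget B) hc)⟩

/-- **A connected `B`-scheme mapping to a coproduct (in `Over B`) of preconnected `B`-schemes by an
open immersion with closed image is `B`-isomorphic, over the apex, to one of the summands**: the
underlying statement is `exists_iso_comp_eq_of_isColimit_cofan`, and an isomorphism of underlying
schemes commuting with the legs automatically commutes with the structure maps to `B`
(Görtz–Wedhorn I, §(3.11), Exercise 3.16; e.g. `B = Spec k`, the tree's `SchemeOver k`). [cite: GortzWedhorn2020, Lemma 1.19 (1) (§(1.5)) with §(3.5) Example 3.11 (p. 73)] -/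
theorem exists_overIso_comp_eq_of_isColimit_cofan (hc : IsColimit (Cofan.mk S f))
    [∀ i, PreconnectedSpace (X i).left] {E : Over B} (j : E ⟶ S) [IsOpenImmersion j.left]
    (hj : IsClosed (Set.range j.left)) [ConnectedSpace E.left] :
    ∃ (i : σ) (φ : E ≅ X i), φ.hom ≫ f i = j := by
  obtain ⟨hc'⟩ := isColimit_cofan_left hc
  obtain ⟨i, ψ, hψ⟩ := exists_iso_comp_eq_of_isColimit_cofan hc' j.left hj
  have hw : ψ.hom ≫ (X i).hom = E.hom := by
    rw [← Over.w (f i), ← Category.assoc, hψ, Over.w j]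
  exact ⟨i, Over.isoMk ψ hw, Over.OverMorphism.ext hψ⟩

/-- **An open-and-closed `B`-immersion of a connected `B`-scheme into a coproduct (in `Over B`) of
preconnected `B`-schemes is, over the apex, the inclusion of one of the summands**
(`exists_overIso_comp_eq_of_isColimit_cofan` with the closed image supplied by the closed immersion;
Görtz–Wedhorn I, §(3.11), Exercise 3.16). [cite: GortzWedhorn2020, Lemma 1.19 (1) (§(1.5)) with §(3.5) Example 3.11 (p. 73)] -/
theorem exists_overIso_comp_eq_of_isColimit_cofan' (hc : IsColimit (Cofan.mk S f))
    [∀ i, PreconnectedSpace (X i).left] {E : Over B} (j : E ⟶ S) [IsOpenImmersion j.left]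
    [IsClosedImmersion j.left] [ConnectedSpace E.left] :
    ∃ (i : σ) (φ : E ≅ X i), φ.hom ≫ f i = j :=
  exists_overIso_comp_eq_of_isColimit_cofan hc j j.left.isClosedEmbedding.isClosed_range

/-- **Consumer form over a one-point base.**  Over a base scheme `B` with exactly one point (e.g.
`B = Spec k`, `k` a field: the tree's `SchemeOver k`), let `(f_i : X_i ⟶ S)` be a colimit cofan in
`Over B` whose summands are geometrically irreducible over `B`, and `j : E ⟶ S` an open-and-closed
`B`-immersion of a geometrically irreducible `E` (for instance summands and piece smooth projective
geometrically irreducible varieties, the fields of the tree's `IsSmoothProjective`).  Then `E` is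
`B`-isomorphic over `S` to one of the summands: geometrically irreducible over a point is irreducible
(Mathlib `GeometricallyIrreducible.irreducibleSpace_of_subsingleton`, Stacks 0366), irreducible is
connected, and `exists_overIso_comp_eq_of_isColimit_cofan'` applies (Görtz–Wedhorn I, §(3.11),
Exercise 3.16). [cite: GortzWedhorn2020, Lemma 1.19 (1) (§(1.5)) with §(3.5) Example 3.11 (p. 73)] -/
theorem exists_overIso_comp_eq_of_geometricallyIrreducible [Subsingleton B] [Nonempty B]
    (hc : IsColimit (Cofan.mk S f)) [∀ i, GeometricallyIrreducible (X i).hom] {E : Over B}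
    (j : E ⟶ S) [IsOpenImmersion j.left] [IsClosedImmersion j.left] [GeometricallyIrreducible E.hom] :
    ∃ (i : σ) (φ : E ≅ X i), φ.hom ≫ f i = j := by
  haveI : ∀ i, PreconnectedSpace (X i).left := fun i =>
    haveI := GeometricallyIrreducible.irreducibleSpace_of_subsingleton (X i).hom
    inferInstance
  haveI := GeometricallyIrreducible.irreducibleSpace_of_subsingleton E.hom
  exact exists_overIso_comp_eq_of_isColimit_cofan' hc j

end Over

end Literature.AlgebraicGeometry.Morphisms

end
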